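import Summits.CriticalPhenomena.PercolationContinuityZ3.Theorems.PercNearOneGluingNoHeavyLowerTailSahiOneStepUniformMonoB
import Summits.CriticalPhenomena.PercolationContinuityZ3.Theorems.PercNearOneGluingNoHeavyLowerTailSahiOneStepUniformPrelim
import HarnessLib

/-!
# One-step scheme: `(2′)` with ONE FREE COORDINATE OF ARBITRARY DENSITY — preliminaries

Support file (prover prim-ineq-prove-3 gen 52; `--supports stmt-CriticalPhenomena-4575`; memo
`run/shared/lean/prim/prim-ineq-prove-3/PROOF-G52-FREE-ODD-COORDINATE.md` §2).  No definitions, no named facts, no sorries.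

Setting.  Slot block `insert e G` with `G = insert o F` (`e, o ∉ F`, `e ≠ o`): the counted coordinates are `F`, the pivot `e` and one extra
coordinate `o` ("free odd coordinate") on which the events do NOT depend (they are `insert e F`-determined) and whose density is arbitrary.
Gen 21's MONO-B (`drift_nonpos_of_dominated`) needs the pivot `e` to be dominated in `B` by EVERY counted coordinate, which fails for `o`
(an `o`-free `B` is not `o`-dominated).  This file proves the replacement:

* `mem_of_union_mem_hgen` / `determinedBy_hgen_of_free` — the `H`-generated hull of an `o`-free increasing event (slot = a threshold slot counting `o`)
  is again `o`-free (`insert e F`-determined);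
* `section_sdiff_mem_of_dominated_free` — for an increasing, `insert e F`-determined, `F`-dominated (every `j ∈ F` beats `e`), `H`-generated `B`
  (`H` = threshold `t+1` on `insert e G`): `insert e ω ∈ B` and `#(G ∩ ω) < t` imply `ω ∖ {e} ∈ B` — the sections of `B` at `e` agree on the
  ball `{N_G < t}` (one level lower than in gen 21's lemma: the witness argument is run on `ω ∪ {o}`);
* `drift_nonpos_of_dominated_free` — hence the ball-conditioned drift `U_B ≤ 0` (hypothesis `hUB` of `osN_ind_ind_nonneg_of_cross`), by ball
  monotonicity on the block `G` (`real_inter_ball_mul_le`, any product measure).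
-/

noncomputable section

namespace Summit.CriticalPhenomena.PercolationContinuityZ3.Theorems

namespace SahiOneStep

open MeasureTheory
open Literature.Probability.Percolation (DeterminedBy determinedBy_iff)
open Literature.Probability.LatticeModels (prodBernoulli)
open Literature.Probability.Percolation.DecisionTree (ind)
open SahiE3Sections (determinedBy_section_insert determinedBy_section_sdiff)
open scoped Classical

variable {ι : Type*} [Fintype ι]

/-! ## `o`-free events and their hulls -/

omit [Fintype ι] in
/-- An event determined by a set `S` not containing `o` is `o`-free: `ω ∪ {o} ∈ X → ω ∈ X`. [folklore] -/
theorem mem_of_union_mem_of_determinedBy {X : Set (Set ι)} {S : Set ι} {o : ι} (hX : DeterminedBy X S) (ho : o ∉ S)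
    {ω : Set ι} (h : ω ∪ {o} ∈ X) : ω ∈ X := by
  rw [determinedBy_iff] at hX
  have hagree : (ω ∪ {o}) ∩ S = ω ∩ S := by
    ext i
    simp only [Set.mem_inter_iff, Set.mem_union, Set.mem_singleton_iff]
    constructor
    · rintro ⟨hi | rfl, hiS⟩
      · exact ⟨hi, hiS⟩
      · exact absurd hiS ho
    · rintro ⟨hi, hiS⟩
      exact ⟨Or.inl hi, hiS⟩
  exact (hX _ _ hagree).1 h

omit [Fintype ι] in
/-- An increasing `o`-free event determined by `S` is determined by `S ∖ {o}`. [folklore] -/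
theorem determinedBy_sdiff_of_free {X : Set (Set ι)} {S : Set ι} {o : ι} (hXup : IsUpperSet X) (hX : DeterminedBy X S)
    (hfree : ∀ ω : Set ι, ω ∪ {o} ∈ X → ω ∈ X) : DeterminedBy X (S \ {o}) := by
  rw [determinedBy_iff] at hX ⊢
  intro ω₁ ω₂ h12
  have hagree : (ω₁ ∪ {o}) ∩ S = (ω₂ ∪ {o}) ∩ S := by
    ext i
    simp only [Set.mem_inter_iff, Set.mem_union, Set.mem_singleton_iff]
    by_cases hio : i = o
    · subst hio; simp
    · have h1 : i ∈ ω₁ ∩ (S \ {o}) ↔ i ∈ ω₂ ∩ (S \ {o}) := by rw [h12]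
      simp only [Set.mem_inter_iff, Set.mem_sdiff, Set.mem_singleton_iff] at h1
      constructor
      · rintro ⟨hi | hi, hiS⟩
        · exact ⟨Or.inl (h1.1 ⟨hi, hiS, hio⟩).1, hiS⟩
        · exact absurd hi hio
      · rintro ⟨hi | hi, hiS⟩
        · exact ⟨Or.inl (h1.2 ⟨hi, hiS, hio⟩).1, hiS⟩
        · exact absurd hi hio
  constructor
  · intro h1
    exact hfree _ ((hX _ _ hagree).1 (hXup Set.subset_union_left h1))
  · intro h2
    exact hfree _ ((hX _ _ hagree).2 (hXup Set.subset_union_left h2))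

omit [Fintype ι] in
/-- The `H`-generated hull of an `o`-free increasing event is `o`-free, for any increasing slot `H`. [this work] -/
theorem mem_hgen_of_union_mem_hgen {H A : Set (Set ι)} (hH : IsUpperSet H) {o : ι}
    (hfree : ∀ ω : Set ι, ω ∪ {o} ∈ A → ω ∈ A) {ω : Set ι}
    (h : ω ∪ {o} ∈ {ω : Set ι | ∀ ω' : Set ι, ω ⊆ ω' → ω' ∈ H → ω' ∈ A}) :
    ω ∈ {ω : Set ι | ∀ ω' : Set ι, ω ⊆ ω' → ω' ∈ H → ω' ∈ A} := by
  intro ω' hsub hH'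
  refine hfree ω' (h (ω' ∪ {o}) (Set.union_subset_union_left _ hsub) (hH Set.subset_union_left hH'))

omit [Fintype ι] in
/-- The hull of an `insert e F`-determined increasing event with respect to a threshold slot on `insert e (insert o F)` (`o ∉ insert e F`)
is again `insert e F`-determined. [this work] -/
theorem determinedBy_hgen_of_free {F : Finset ι} {e o : ι} (ho : o ∉ insert e F) (t : ℕ) {A : Set (Set ι)}
    (hAF : DeterminedBy A (↑(insert e F) : Set ι)) :
    DeterminedBy {ω : Set ι | ∀ ω' : Set ι, ω ⊆ ω' → ω' ∈ {ω : Set ι | t ≤ ((insert e (insert o F)).filter (· ∈ ω)).card} → ω' ∈ A}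
      (↑(insert e F) : Set ι) := by
  have hcoe : (↑(insert e (insert o F)) : Set ι) \ {o} = ↑(insert e F) := by
    ext i
    simp only [Set.mem_sdiff, Finset.coe_insert, Set.mem_insert_iff, Finset.mem_coe, Set.mem_singleton_iff]
    constructor
    · rintro ⟨h | h | h, hne⟩
      · exact Or.inl h
      · exact absurd h hne
      · exact Or.inr h
    · intro h
      refine ⟨?_, fun hio => ho (hio ▸ (by simpa [Finset.mem_insert] using h))⟩
      rcases h with h | h
      · exact Or.inl h
      · exact Or.inr (Or.inr h)
  have hAG : DeterminedBy A (↑(insert e (insert o F)) : Set ι) :=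
    hAF.mono (by intro i hi; simp only [Finset.coe_insert, Set.mem_insert_iff, Finset.mem_coe] at hi ⊢; tauto)
  have hgenG := determinedBy_hgen (determinedBy_threshold (insert e (insert o F)) t) hAG
  rw [← hcoe]
  refine determinedBy_sdiff_of_free (isUpperSet_hgen _ A) hgenG ?_
  intro ω hω
  exact mem_hgen_of_union_mem_hgen (isUpperSet_threshold _ t)
    (fun ω' h' => mem_of_union_mem_of_determinedBy hAF (by exact_mod_cast ho) h') hω

/-! ## MONO-B with a free coordinate -/

omit [Fintype ι] in
/-- **Core of MONO-B with a free coordinate.**  Block `insert e G`, `G = insert o F`, `e ∉ G`, `o ∉ F`; `B` increasing, `insert e F`-determined,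
`F`-dominated at `e` and `H`-generated for the threshold slot `t+1` of `insert e G`.  If `insert e ω ∈ B` and `#(G ∩ ω) < t` then `ω ∖ {e} ∈ B`.
(Run gen 21's witness argument on `ω ∪ {o}`: a witness `z ⊇ (ω ∪ {o}) ∖ {e}` in `H ∖ B` avoids `e`, every `j ∈ F ∩ z` outside `ω` could be traded
for `e`, so `G ∩ z ⊆ G ∩ (ω ∪ {o})` has at most `t` elements, contradicting `z ∈ H`; finally `o`-freeness removes `o`.) [this work] -/
theorem section_sdiff_mem_of_dominated_free {F : Finset ι} {e o : ι} (heo : e ≠ o) (heF : e ∉ F) (hoF : o ∉ F) {t : ℕ}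
    {B : Set (Set ι)} (hB : IsUpperSet B) (hBF : DeterminedBy B (↑(insert e F) : Set ι))
    (hdom : ∀ ω ∈ B, e ∈ ω → ∀ j ∈ F, j ∉ ω → (ω \ {e}) ∪ {j} ∈ B)
    (hgen : ∀ ω : Set ι, (∀ ω' : Set ι, ω ⊆ ω' → t + 1 ≤ ((insert e (insert o F)).filter (· ∈ ω')).card → ω' ∈ B) → ω ∈ B)
    {ω : Set ι} (hω : insert e ω ∈ B) (hsmall : ((insert o F).filter (· ∈ ω)).card < t) :
    ω \ {e} ∈ B := by
  have hoeF : o ∉ insert e F := by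
    intro h
    rcases Finset.mem_insert.1 h with h | h
    · exact heo h.symm
    · exact hoF h
  -- work with `ωo = ω ∪ {o}`
  set ωo : Set ι := ω ∪ {o} with hωo
  suffices hplus : ωo \ {e} ∈ B by
    refine mem_of_union_mem_of_determinedBy hBF (by exact_mod_cast hoeF) ?_
    have : ω \ {e} ∪ {o} = ωo \ {e} := by
      ext x
      simp only [hωo, Set.mem_union, Set.mem_sdiff, Set.mem_singleton_iff]
      constructor
      · rintro (⟨hx, hxe⟩ | rfl)
        · exact ⟨Or.inl hx, hxe⟩
        · exact ⟨Or.inr rfl, fun h => heo h.symm⟩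
      · rintro ⟨hx | rfl, hxe⟩
        · exact Or.inl ⟨hx, hxe⟩
        · exact Or.inr rfl
    rw [this]; exact hplus
  have hωoB : insert e ωo ∈ B := hB (Set.insert_subset_insert Set.subset_union_left) hω
  by_contra hnot
  have hex : ∃ z : Set ι, ωo \ {e} ⊆ z ∧ t + 1 ≤ ((insert e (insert o F)).filter (· ∈ z)).card ∧ z ∉ B := by
    by_contra h
    push Not at h
    exact hnot (hgen _ fun ω' h1 h2 => h ω' h1 h2)
  obtain ⟨z, hsub, hzH, hzB⟩ := hex
  -- `e ∉ z`
  have hez : e ∉ z := by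
    intro hez
    refine hzB (hB ?_ hωoB)
    intro x hx
    rcases hx with rfl | hx
    · exact hez
    · by_cases hxe : x = e
      · exact hxe ▸ hez
      · exact hsub ⟨hx, hxe⟩
  -- `F ∩ z ⊆ ωo`
  have hFz : ∀ j ∈ F, j ∈ z → j ∈ ωo := by
    intro j hjF hjz
    by_contra hjω
    have hje : j ≠ e := fun h => heF (h ▸ hjF)
    have hz'B : (z \ {j}) ∪ {e} ∉ B := by
      intro hz'B
      have hjz' : j ∉ (z \ {j}) ∪ {e} := by
        rintro (⟨_, hj⟩ | hj)
        · exact hj rfl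
        · exact hje hj
      have h := hdom _ hz'B (Or.inr rfl) j hjF hjz'
      have heq : ((z \ {j}) ∪ {e}) \ {e} ∪ {j} = z := by
        ext x
        simp only [Set.mem_union, Set.mem_sdiff, Set.mem_singleton_iff]
        constructor
        · rintro (⟨⟨hx, _⟩ | hx, hxe⟩ | rfl)
          · exact hx
          · exact absurd hx hxe
          · exact hjz
        · intro hx
          by_cases hxj : x = j
          · exact Or.inr hxj
          · exact Or.inl ⟨Or.inl ⟨hx, hxj⟩, fun hxe => hez (hxe ▸ hx)⟩
      rw [heq] at h
      exact hzB h
    have hz'H : t + 1 ≤ ((insert e (insert o F)).filter (· ∈ (z \ {j}) ∪ {e})).card := by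
      have hfe : (insert e (insert o F)).filter (· ∈ (z \ {j}) ∪ {e}) =
          insert e (((insert e (insert o F)).filter (· ∈ z)).erase j) := by
        ext i
        simp only [Finset.mem_filter, Finset.mem_insert, Finset.mem_erase, Set.mem_union, Set.mem_sdiff,
          Set.mem_singleton_iff]
        constructor
        · rintro ⟨hi, ⟨hiz, hij⟩ | hie⟩
          · exact Or.inr ⟨hij, hi, hiz⟩
          · exact Or.inl hie
        · rintro (hie | ⟨hij, hi, hiz⟩)
          · exact ⟨Or.inl hie, Or.inr hie⟩
          · exact ⟨hi, Or.inl ⟨hiz, hij⟩⟩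
      have hjmem : j ∈ (insert e (insert o F)).filter (· ∈ z) :=
        Finset.mem_filter.2 ⟨Finset.mem_insert_of_mem (Finset.mem_insert_of_mem hjF), hjz⟩
      have hemem : e ∉ ((insert e (insert o F)).filter (· ∈ z)).erase j :=
        fun h => hez (Finset.mem_filter.1 (Finset.mem_of_mem_erase h)).2
      rw [hfe, Finset.card_insert_of_notMem hemem, Finset.card_erase_of_mem hjmem]
      have hpos : 0 < ((insert e (insert o F)).filter (· ∈ z)).card := Finset.card_pos.2 ⟨j, hjmem⟩
      omega
    have hsub' : insert e ωo ⊆ (z \ {j}) ∪ {e} := by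
      intro x hx
      rcases hx with rfl | hx
      · exact Or.inr rfl
      · by_cases hxe : x = e
        · exact Or.inr hxe
        · exact Or.inl ⟨hsub ⟨hx, hxe⟩, fun hxj => hjω (hxj ▸ hx)⟩
    exact hz'B (hB hsub' hωoB)
  -- count: `t+1 ≤ #(insert e G ∩ z) = #(G ∩ z) ≤ #(G ∩ ωo) ≤ #(G ∩ ω) + 1 ≤ t`
  have h1 : ((insert e (insert o F)).filter (· ∈ z)).card = ((insert o F).filter (· ∈ z)).card := by
    rw [Finset.filter_insert, if_neg hez]
  have hoz : ∀ j ∈ insert o F, j ∈ z → j ∈ ωo := by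
    intro j hj hjz
    rcases Finset.mem_insert.1 hj with rfl | hjF
    · exact Or.inr rfl
    · exact hFz j hjF hjz
  have h2 : ((insert o F).filter (· ∈ z)).card ≤ ((insert o F).filter (· ∈ ωo)).card :=
    Finset.card_le_card fun j hj => by
      rw [Finset.mem_filter] at hj ⊢
      exact ⟨hj.1, hoz j hj.1 hj.2⟩
  have h3 : ((insert o F).filter (· ∈ ωo)).card ≤ ((insert o F).filter (· ∈ ω)).card + 1 := by
    have hsub3 : (insert o F).filter (· ∈ ωo) ⊆ insert o ((insert o F).filter (· ∈ ω)) := by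
      intro j hj
      rw [Finset.mem_filter] at hj
      rcases hj.2 with hjω | hjo
      · exact Finset.mem_insert_of_mem (Finset.mem_filter.2 ⟨hj.1, hjω⟩)
      · exact Finset.mem_insert.2 (Or.inl hjo)
    exact (Finset.card_le_card hsub3).trans (Finset.card_insert_le _ _)
  omega

omit [Fintype ι] in
/-- Consequently the two sections of `B` at `e` agree on the ball `{N_G < s}` for every `s ≤ t` (`G = insert o F`). [this work] -/
theorem section_inter_ball_eq_of_dominated_free {F : Finset ι} {e o : ι} (heo : e ≠ o) (heF : e ∉ F) (hoF : o ∉ F) {t : ℕ}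
    {B : Set (Set ι)} (hB : IsUpperSet B) (hBF : DeterminedBy B (↑(insert e F) : Set ι))
    (hdom : ∀ ω ∈ B, e ∈ ω → ∀ j ∈ F, j ∉ ω → (ω \ {e}) ∪ {j} ∈ B)
    (hgen : ∀ ω : Set ι, (∀ ω' : Set ι, ω ⊆ ω' → t + 1 ≤ ((insert e (insert o F)).filter (· ∈ ω')).card → ω' ∈ B) → ω ∈ B)
    {s : ℕ} (hs : s ≤ t) :
    {ω : Set ι | insert e ω ∈ B} ∩ {ω : Set ι | ((insert o F).filter (· ∈ ω)).card < s} =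
      {ω : Set ι | ω \ {e} ∈ B} ∩ {ω : Set ι | ((insert o F).filter (· ∈ ω)).card < s} := by
  ext ω
  simp only [Set.mem_inter_iff, Set.mem_setOf_eq]
  constructor
  · rintro ⟨h1, h2⟩
    exact ⟨section_sdiff_mem_of_dominated_free heo heF hoF hB hBF hdom hgen h1 (by omega), h2⟩
  · rintro ⟨h0, h2⟩
    exact ⟨section_sdiff_subset_section_insert hB e h0, h2⟩

/-- **MONO-B WITH A FREE COORDINATE**: for the threshold slot `H = {t+1 ≤ #(insert e (insert o F) ∩ ω)}` (`e ∉ F`, `o ∉ F`, `e ≠ o`) and an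
increasing, `insert e F`-determined (so `o`-free), `F`-dominated, `H`-generated event `B`, the ball-conditioned drift `U_B` of the cross-form step
lemma is `≤ 0` — whatever the density of `o`. [this work] -/
theorem drift_nonpos_of_dominated_free (p : ι → unitInterval) {F : Finset ι} {e o : ι} (heo : e ≠ o) (heF : e ∉ F) (hoF : o ∉ F)
    (t : ℕ) {B : Set (Set ι)} (hB : IsUpperSet B) (hBF : DeterminedBy B (↑(insert e F) : Set ι))
    (hdom : ∀ ω ∈ B, e ∈ ω → ∀ j ∈ F, j ∉ ω → (ω \ {e}) ∪ {j} ∈ B)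
    (hgen : ∀ ω : Set ι, (∀ ω' : Set ι, ω ⊆ ω' → t + 1 ≤ ((insert e (insert o F)).filter (· ∈ ω')).card → ω' ∈ B) → ω ∈ B) :
    (1 - (prodBernoulli p).real {ω : Set ι | ω \ {e} ∈ {ω : Set ι | t + 1 ≤ ((insert e (insert o F)).filter (· ∈ ω)).card}}) *
          ((prodBernoulli p).real {ω : Set ι | insert e ω ∈ B} -
            (prodBernoulli p).real ({ω : Set ι | insert e ω ∈ {ω : Set ι | t + 1 ≤ ((insert e (insert o F)).filter (· ∈ ω)).card}} ∩
              {ω : Set ι | insert e ω ∈ B}))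
        - (1 - (prodBernoulli p).real {ω : Set ι | insert e ω ∈ {ω : Set ι | t + 1 ≤ ((insert e (insert o F)).filter (· ∈ ω)).card}}) *
          ((prodBernoulli p).real {ω : Set ι | ω \ {e} ∈ B} -
            (prodBernoulli p).real ({ω : Set ι | ω \ {e} ∈ {ω : Set ι | t + 1 ≤ ((insert e (insert o F)).filter (· ∈ ω)).card}} ∩
              {ω : Set ι | ω \ {e} ∈ B})) ≤ 0 := by
  have heG : e ∉ insert o F := by
    intro h
    rcases Finset.mem_insert.1 h with h | h
    · exact heo h
    · exact heF h
  rw [section_insert_threshold heG, section_sdiff_threshold heG, one_sub_real_threshold, one_sub_real_threshold,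
    real_sub_real_threshold_inter, real_sub_real_threshold_inter]
  have hcoe : (↑(insert e F) : Set ι) \ {e} = ↑F := by
    ext i
    simp only [Set.mem_sdiff, Finset.coe_insert, Set.mem_insert_iff, Finset.mem_coe, Set.mem_singleton_iff]
    constructor
    · rintro ⟨h | h, hne⟩
      · exact absurd h hne
      · exact h
    · intro h
      exact ⟨Or.inr h, fun hie => heF (hie ▸ h)⟩
  have hB0F : DeterminedBy {ω : Set ι | ω \ {e} ∈ B} (↑F : Set ι) := hcoe ▸ determinedBy_section_sdiff hBF e
  have hB0G : DeterminedBy {ω : Set ι | ω \ {e} ∈ B} (↑(insert o F) : Set ι) :=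
    hB0F.mono (by intro i hi; simp only [Finset.coe_insert, Set.mem_insert_iff, Finset.mem_coe] at hi ⊢; exact Or.inr hi)
  have hB0 : IsUpperSet {ω : Set ι | ω \ {e} ∈ B} := isUpperSet_section_sdiff hB e
  rw [section_inter_ball_eq_of_dominated_free heo heF hoF hB hBF hdom hgen le_rfl]
  have h := real_inter_ball_mul_le p (insert o F) hB0 hB0G t
  linarith

end SahiOneStep

end Summit.CriticalPhenomena.PercolationContinuityZ3.Theorems
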